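import Literature.NumberTheory.Rogawski1990.ArchHyperbolicOrbitMeasure       -- ★ p848923: `exists_quotientMeasure_hsOrbitBall_le_sqrt_of_split`, `hs_out_conj_eq` (head (ii), diagonal model)
import Literature.MeasureTheory.Group.InvariantQuotientOrbitalTransport      -- ★ `cosetCongr`, `exists_eq_smul_map_cosetCongr_centralizer`, `descConj`, `centralizer_comm`
import HarnessLib

/-!
# Transport of the split-orbit quotient-volume bound to ANY split regular class, ANY invariant measure and ANY bicontinuously isomorphic carrier
# (head (ii) PART 3 of DEAL #11 «(VOL-split-measure)»: the adapter to the per-place token `hplace` of the (CONV) assembler; Beuzart-Plessis 2020 §1.2, §1.8)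

Topic `NumberTheory/Rogawski1990`; namespace `Literature.NumberTheory.Rogawski1990`.  THEOREMS ONLY (no `def`, no instance, no notation, no axiom, no named fact,
no `sorry`).  Cell `pub/hodgecm-mathlib`, crux H413 (`stmt-HodgeConjecture-24833`), F0∕P3c line LH3 kit, DEAL #11 of LH3-plan (g0); LHref-N (g0) A-box (γ-3)
2026-09-02T03:55:32Z «ADAPTER LIST (γ) → (β)'s split-place `hplace`: (a) carrier, (b) conjugate class, (c) radius `+1`, (d) `√R` vs `R^(1∕2)`, (e) any invariant
measure»; seat LH2-p04 (g2).  Items (b)(c)(d)(e) are discharged here in ONE transport theorem; (a) is the choice `e := MulEquiv.subgroupCongr _` at the call site.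

THE MATHEMATICS.  Let `G = U(Φ₂)(ℂ)`, `γ = diag(z₀a, z₀b)` the diagonal split regular model of ★ `ArchHyperbolicOrbitMeasure` (with its Haar data `ν`, `ρ` and the
(T2e) identification `hν`), and let `G₀` be any locally compact second countable group with a bicontinuous isomorphism `e : G₀ ≃* G` and `γ₀ ∈ G₀` whose image is
CONJUGATE to the model, `e γ₀ = h γ h⁻¹`.  Then for EVERY `G₀`-invariant measure `μ₀` on `G₀ ⧸ G₀_{γ₀}` finite on compact sets there is `C` with
  `μ₀ {x ∣ Σ_ij |(e(x γ₀ x⁻¹))_ij|² ≤ R} ≤ C √R`   for all `R`            (`exists_measure_descConj_hs_le_sqrt_of_split`),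
and, in the letters of the (CONV) assembler's per-place token, `μ₀ {x ∣ Σ_ij |(e(x γ₀ x⁻¹))_ij|² + 1 ≤ t} ≤ C · t^(1∕2)` for `t ≥ 1`
(`exists_measure_descConj_hs_add_one_le_rpow_of_split`).  PROOF: `f := conj(h) ≫ e⁻¹ : G ≃* G₀` maps `γ ↦ γ₀`; by ★ `exists_eq_smul_map_cosetCongr_centralizer`
(uniqueness of invariant measures on `G₀ ⧸ G₀_{γ₀}`) `μ₀ = c′ • (cosetCongr f)_* μ` with `μ` the model quotient measure; the pulled-back ball is the `h`-TRANSLATE of the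
model ball (`e(f(g) γ₀ f(g)⁻¹) = (hg) γ (hg)⁻¹`), of the same `μ`-mass by invariance; ★ `exists_quotientMeasure_hsOrbitBall_le_sqrt_of_split` bounds it by `C√R`.
[BeuzartPlessis2020Asterisque, §1.2 (1.2.2), (1.2.4) p. 21; §1.8 p. 39: the orbit estimates depend on the CLASS only.]
ED. 2 (docstring-only): sub-locators re-pinned per lit4-(205)∕(210) L3-BP1∕L3-B2 (Beuzart-Plessis §1.8 p. 39, §1.2 (1.2.2)∕(1.2.4) p. 21; Borel §2.9); no statement or proof byte changed.
HONEST LABEL: HC_CM is proved only modulo the 7 printed citations (2 remaining: hLiu418 = stmt-HodgeConjecture-24832, h413 = stmt-HodgeConjecture-24833) until rung 0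
closes; count-neutral kit under the LETTERS O1∕O3 (`stub_N9`) and O1″∕O3″ (`stub_N8`).

## References
* [BeuzartPlessis2020Asterisque] R. Beuzart-Plessis, *A local trace formula for the Gan–Gross–Prasad conjecture for unitary groups: the archimedean case*,
  Astérisque 418 (2020), §1.8 p. 39; §1.2 (1.2.2), (1.2.4) p. 21.
* [Folland1995] G. B. Folland, *A Course in Abstract Harmonic Analysis* (1995), §2.6 Thm. 2.49 (uniqueness of invariant measures on `G ⧸ H`).
-/

set_option autoImplicit false

noncomputable section

open Complex MeasureTheory Set Literature.MeasureTheory.Group Literature.NumberTheory.Automorphic Literature.NumberTheory.Automorphic.UnitaryGroup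
open scoped Matrix ComplexConjugate NNReal ENNReal Real

namespace Literature.NumberTheory.Rogawski1990

section Transport

variable [MeasurableSpace (Matrix (Fin 2) (Fin 2) ℝ)] [BorelSpace (Matrix (Fin 2) (Fin 2) ℝ)] [MeasurableSpace Circle] [BorelSpace Circle]
  [MeasurableSpace ↥(unitaryGroupOfForm (starRingEnd ℂ) (Matrix.of fun i j : Fin 2 => if i.val + j.val + 1 = 2 then (1 : ℂ) else 0))] [BorelSpace ↥(unitaryGroupOfForm (starRingEnd ℂ) (Matrix.of fun i j : Fin 2 => if i.val + j.val + 1 = 2 then (1 : ℂ) else 0))]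
  [LocallyCompactSpace ↥(unitaryGroupOfForm (starRingEnd ℂ) (Matrix.of fun i j : Fin 2 => if i.val + j.val + 1 = 2 then (1 : ℂ) else 0))] [SecondCountableTopology ↥(unitaryGroupOfForm (starRingEnd ℂ) (Matrix.of fun i j : Fin 2 => if i.val + j.val + 1 = 2 then (1 : ℂ) else 0))]
  {G₀ : Type*} [Group G₀] [TopologicalSpace G₀] [IsTopologicalGroup G₀] [LocallyCompactSpace G₀] [SecondCountableTopology G₀] [T2Space G₀]

/-- **TRANSPORT OF THE SPLIT-ORBIT BOUND** to any bicontinuously isomorphic carrier `e : G₀ ≃* U(Φ₂)(ℂ)`, any class `γ₀` with `e γ₀ = h γ h⁻¹` conjugate to the diagonal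
split regular model `γ = diag(z₀a, z₀b)`, and ANY `G₀`-invariant measure `μ₀` on `G₀ ⧸ G₀_{γ₀}` finite on compact sets: `μ₀{Σ|(e(x γ₀ x⁻¹))_ij|² ≤ R} ≤ C √R` for all `R`
(given the (T2e) identification `hν` for one Haar frame `ν`, `ρ` of the model). [cite: BeuzartPlessis2020Asterisque, §1.8 p. 39; §1.2 (1.2.2), (1.2.4) p. 21] [cite: Folland1995, §2.6 Thm. 2.49] -/
theorem exists_measure_descConj_hs_le_sqrt_of_split
    (e : G₀ ≃* ↥(unitaryGroupOfForm (starRingEnd ℂ) (Matrix.of fun i j : Fin 2 => if i.val + j.val + 1 = 2 then (1 : ℂ) else 0))) (he : Continuous e) (hes : Continuous e.symm)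
    {γ : ↥(unitaryGroupOfForm (starRingEnd ℂ) (Matrix.of fun i j : Fin 2 => if i.val + j.val + 1 = 2 then (1 : ℂ) else 0))} {z₀ : ℂ} {a b : ℝ} (hγ : (((γ : ↥(unitaryGroupOfForm (starRingEnd ℂ) (Matrix.of fun i j : Fin 2 => if i.val + j.val + 1 = 2 then (1 : ℂ) else 0))) : GL (Fin 2) ℂ) : Matrix (Fin 2) (Fin 2) ℂ) = !![z₀ * a, 0; 0, z₀ * b]) (hz₀ : ‖z₀‖ = 1) (hab : a ≠ b)
    (ν : Measure ↥(unitaryGroupOfForm (starRingEnd ℂ) (Matrix.of fun i j : Fin 2 => if i.val + j.val + 1 = 2 then (1 : ℂ) else 0))) [ν.IsHaarMeasure] [ν.IsMulRightInvariant] [ν.IsInvInvariant]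
    (ρ : Measure ↥(Subgroup.centralizer ({γ} : Set ↥(unitaryGroupOfForm (starRingEnd ℂ) (Matrix.of fun i j : Fin 2 => if i.val + j.val + 1 = 2 then (1 : ℂ) else 0))))) [ρ.IsHaarMeasure] [ρ.IsInvInvariant]
    [MeasurableSpace (↥(unitaryGroupOfForm (starRingEnd ℂ) (Matrix.of fun i j : Fin 2 => if i.val + j.val + 1 = 2 then (1 : ℂ) else 0)) ⧸ Subgroup.centralizer ({γ} : Set ↥(unitaryGroupOfForm (starRingEnd ℂ) (Matrix.of fun i j : Fin 2 => if i.val + j.val + 1 = 2 then (1 : ℂ) else 0))))] [BorelSpace (↥(unitaryGroupOfForm (starRingEnd ℂ) (Matrix.of fun i j : Fin 2 => if i.val + j.val + 1 = 2 then (1 : ℂ) else 0)) ⧸ Subgroup.centralizer ({γ} : Set ↥(unitaryGroupOfForm (starRingEnd ℂ) (Matrix.of fun i j : Fin 2 => if i.val + j.val + 1 = 2 then (1 : ℂ) else 0))))]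
    (μc : Measure Circle) [IsFiniteMeasure μc] {c : ℝ≥0} (hc : c ≠ 0)
    (hν : Measure.map archPlaneLiftUnitary (μc.prod iwasawaMeasure) = c • ν)
    {γ₀ : G₀} (h : ↥(unitaryGroupOfForm (starRingEnd ℂ) (Matrix.of fun i j : Fin 2 => if i.val + j.val + 1 = 2 then (1 : ℂ) else 0))) (hconj : e γ₀ = h * γ * h⁻¹)
    [MeasurableSpace (G₀ ⧸ Subgroup.centralizer ({γ₀} : Set G₀))] [BorelSpace (G₀ ⧸ Subgroup.centralizer ({γ₀} : Set G₀))]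
    (μ₀ : Measure (G₀ ⧸ Subgroup.centralizer ({γ₀} : Set G₀))) [SMulInvariantMeasure G₀ (G₀ ⧸ Subgroup.centralizer ({γ₀} : Set G₀)) μ₀] [IsFiniteMeasureOnCompacts μ₀] :
    ∃ C : ℝ, ∀ R : ℝ, μ₀ {x | descConj γ₀ (Subgroup.centralizer ({γ₀} : Set G₀)) (centralizer_comm γ₀)
        (fun y : G₀ => ∑ i : Fin 2, ∑ j : Fin 2, ‖(((e y : ↥(unitaryGroupOfForm (starRingEnd ℂ) (Matrix.of fun i j : Fin 2 => if i.val + j.val + 1 = 2 then (1 : ℂ) else 0))) : GL (Fin 2) ℂ) : Matrix (Fin 2) (Fin 2) ℂ) i j‖ ^ 2) x ≤ R} ≤ ENNReal.ofReal (C * Real.sqrt R) := by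
  haveI hT : IsClosed ((Subgroup.centralizer ({γ} : Set ↥(unitaryGroupOfForm (starRingEnd ℂ) (Matrix.of fun i j : Fin 2 => if i.val + j.val + 1 = 2 then (1 : ℂ) else 0)))) : Set ↥(unitaryGroupOfForm (starRingEnd ℂ) (Matrix.of fun i j : Fin 2 => if i.val + j.val + 1 = 2 then (1 : ℂ) else 0))) := Set.isClosed_centralizer _
  haveI hT₀ : IsClosed ((Subgroup.centralizer ({γ₀} : Set G₀)) : Set G₀) := Set.isClosed_centralizer _
  letI : MeasurableSpace G₀ := borel G₀
  haveI : BorelSpace G₀ := ⟨rfl⟩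
  -- the model bound
  obtain ⟨C, hC⟩ := exists_quotientMeasure_hsOrbitBall_le_sqrt_of_split hγ hz₀ hab ν ρ μc hc hν
  by_cases hμ₀ : μ₀ = 0
  · exact ⟨0, fun R => by rw [hμ₀, Measure.coe_zero, Pi.zero_apply]; exact bot_le⟩
  -- the isomorphism `f = conj(h) ≫ e⁻¹ : G ≃* G₀`, `f γ = γ₀`
  set f : ↥(unitaryGroupOfForm (starRingEnd ℂ) (Matrix.of fun i j : Fin 2 => if i.val + j.val + 1 = 2 then (1 : ℂ) else 0)) ≃* G₀ := (MulAut.conj h).trans e.symm with hf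
  have hfapply : ∀ u : ↥(unitaryGroupOfForm (starRingEnd ℂ) (Matrix.of fun i j : Fin 2 => if i.val + j.val + 1 = 2 then (1 : ℂ) else 0)), f u = e.symm (h * u * h⁻¹) := fun u => rfl
  have hef : ∀ u : ↥(unitaryGroupOfForm (starRingEnd ℂ) (Matrix.of fun i j : Fin 2 => if i.val + j.val + 1 = 2 then (1 : ℂ) else 0)), e (f u) = h * u * h⁻¹ := fun u => by rw [hfapply, MulEquiv.apply_symm_apply]
  have hfγ : f γ = γ₀ := by
    apply e.injective
    rw [hef, hconj]
  have hfc : Continuous f := by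
    have h1 : Continuous fun u : ↥(unitaryGroupOfForm (starRingEnd ℂ) (Matrix.of fun i j : Fin 2 => if i.val + j.val + 1 = 2 then (1 : ℂ) else 0)) => h * u * h⁻¹ := (continuous_const.mul continuous_id).mul continuous_const
    exact hes.comp h1
  have hfsymm : ∀ y : G₀, f.symm y = h⁻¹ * e y * h := fun y => by
    apply f.injective
    rw [MulEquiv.apply_symm_apply]
    apply e.injective
    rw [hef]
    group
  have hfs : Continuous f.symm := by
    have h1 : Continuous fun y : G₀ => h⁻¹ * e y * h := (continuous_const.mul he).mul continuous_const
    exact (continuous_congr hfsymm).2 h1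
  -- the model quotient measure
  set μ := quotientMeasure (Subgroup.centralizer ({γ} : Set ↥(unitaryGroupOfForm (starRingEnd ℂ) (Matrix.of fun i j : Fin 2 => if i.val + j.val + 1 = 2 then (1 : ℂ) else 0)))) ρ (Set.isClosed_centralizer ({γ} : Set ↥(unitaryGroupOfForm (starRingEnd ℂ) (Matrix.of fun i j : Fin 2 => if i.val + j.val + 1 = 2 then (1 : ℂ) else 0)))) ν with hμ
  have hμne : μ ≠ 0 := quotientMeasure_ne_zero _ _ _ _
  obtain ⟨c', hc'0, hμ₀eq⟩ := exists_eq_smul_map_cosetCongr_centralizer f hfc hfs hfγ μ μ₀ hμne hμ₀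
  refine ⟨(c' : ℝ) * C, fun R => ?_⟩
  -- the two balls
  set E₀ : Set (G₀ ⧸ Subgroup.centralizer ({γ₀} : Set G₀)) := {x | descConj γ₀ (Subgroup.centralizer ({γ₀} : Set G₀)) (centralizer_comm γ₀)
      (fun y : G₀ => ∑ i : Fin 2, ∑ j : Fin 2, ‖(((e y : ↥(unitaryGroupOfForm (starRingEnd ℂ) (Matrix.of fun i j : Fin 2 => if i.val + j.val + 1 = 2 then (1 : ℂ) else 0))) : GL (Fin 2) ℂ) : Matrix (Fin 2) (Fin 2) ℂ) i j‖ ^ 2) x ≤ R} with hE₀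
  set E : Set (↥(unitaryGroupOfForm (starRingEnd ℂ) (Matrix.of fun i j : Fin 2 => if i.val + j.val + 1 = 2 then (1 : ℂ) else 0)) ⧸ Subgroup.centralizer ({γ} : Set ↥(unitaryGroupOfForm (starRingEnd ℂ) (Matrix.of fun i j : Fin 2 => if i.val + j.val + 1 = 2 then (1 : ℂ) else 0)))) := {x | ∑ i : Fin 2, ∑ j : Fin 2, ‖(((x.out * γ * x.out⁻¹ : ↥(unitaryGroupOfForm (starRingEnd ℂ) (Matrix.of fun i j : Fin 2 => if i.val + j.val + 1 = 2 then (1 : ℂ) else 0))) : GL (Fin 2) ℂ) : Matrix (Fin 2) (Fin 2) ℂ) i j‖ ^ 2 ≤ R} with hE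
  -- continuity of matrix coefficients
  have hv : Continuous fun u : ↥(unitaryGroupOfForm (starRingEnd ℂ) (Matrix.of fun i j : Fin 2 => if i.val + j.val + 1 = 2 then (1 : ℂ) else 0)) => (((u : ↥(unitaryGroupOfForm (starRingEnd ℂ) (Matrix.of fun i j : Fin 2 => if i.val + j.val + 1 = 2 then (1 : ℂ) else 0))) : GL (Fin 2) ℂ) : Matrix (Fin 2) (Fin 2) ℂ) := Units.continuous_val.comp continuous_subtype_val
  have hHS0 : ∀ (φ : G₀ → ↥(unitaryGroupOfForm (starRingEnd ℂ) (Matrix.of fun i j : Fin 2 => if i.val + j.val + 1 = 2 then (1 : ℂ) else 0))), Continuous φ →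
      Continuous fun x => ∑ i : Fin 2, ∑ j : Fin 2, ‖(((φ x : ↥(unitaryGroupOfForm (starRingEnd ℂ) (Matrix.of fun i j : Fin 2 => if i.val + j.val + 1 = 2 then (1 : ℂ) else 0))) : GL (Fin 2) ℂ) : Matrix (Fin 2) (Fin 2) ℂ) i j‖ ^ 2 := by
    intro φ hφ
    exact continuous_finsetSum _ fun i _ => continuous_finsetSum _ fun j _ =>
      (((continuous_apply j).comp ((continuous_apply i).comp (hv.comp hφ))).norm).pow 2
  have hHS1 : ∀ (φ : ↥(unitaryGroupOfForm (starRingEnd ℂ) (Matrix.of fun i j : Fin 2 => if i.val + j.val + 1 = 2 then (1 : ℂ) else 0)) → ↥(unitaryGroupOfForm (starRingEnd ℂ) (Matrix.of fun i j : Fin 2 => if i.val + j.val + 1 = 2 then (1 : ℂ) else 0))), Continuous φ →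
      Continuous fun x => ∑ i : Fin 2, ∑ j : Fin 2, ‖(((φ x : ↥(unitaryGroupOfForm (starRingEnd ℂ) (Matrix.of fun i j : Fin 2 => if i.val + j.val + 1 = 2 then (1 : ℂ) else 0))) : GL (Fin 2) ℂ) : Matrix (Fin 2) (Fin 2) ℂ) i j‖ ^ 2 := by
    intro φ hφ
    exact continuous_finsetSum _ fun i _ => continuous_finsetSum _ fun j _ =>
      (((continuous_apply j).comp ((continuous_apply i).comp (hv.comp hφ))).norm).pow 2
  have hconj0 : Continuous (fun g : G₀ => g * γ₀ * g⁻¹) := (continuous_id.mul continuous_const).mul continuous_inv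
  have hconj1 : Continuous (fun g : ↥(unitaryGroupOfForm (starRingEnd ℂ) (Matrix.of fun i j : Fin 2 => if i.val + j.val + 1 = 2 then (1 : ℂ) else 0)) => g * γ * g⁻¹) := (continuous_id.mul continuous_const).mul continuous_inv
  -- measurability of the balls
  have hE₀m : MeasurableSet E₀ := by
    have hP : Measurable (descConj γ₀ (Subgroup.centralizer ({γ₀} : Set G₀)) (centralizer_comm γ₀)
        (fun y : G₀ => ∑ i : Fin 2, ∑ j : Fin 2, ‖(((e y : ↥(unitaryGroupOfForm (starRingEnd ℂ) (Matrix.of fun i j : Fin 2 => if i.val + j.val + 1 = 2 then (1 : ℂ) else 0))) : GL (Fin 2) ℂ) : Matrix (Fin 2) (Fin 2) ℂ) i j‖ ^ 2)) := by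
      rw [measurable_quotient_iff (H := Subgroup.centralizer ({γ₀} : Set G₀)) hT₀, descConj_comp_mk]
      exact (hHS0 (fun g : G₀ => e (g * γ₀ * g⁻¹)) (he.comp hconj0)).measurable
    exact measurableSet_le hP measurable_const
  have hEm : MeasurableSet E := by
    have hP : Measurable fun x : ↥(unitaryGroupOfForm (starRingEnd ℂ) (Matrix.of fun i j : Fin 2 => if i.val + j.val + 1 = 2 then (1 : ℂ) else 0)) ⧸ Subgroup.centralizer ({γ} : Set ↥(unitaryGroupOfForm (starRingEnd ℂ) (Matrix.of fun i j : Fin 2 => if i.val + j.val + 1 = 2 then (1 : ℂ) else 0))) => ∑ i : Fin 2, ∑ j : Fin 2, ‖(((x.out * γ * x.out⁻¹ : ↥(unitaryGroupOfForm (starRingEnd ℂ) (Matrix.of fun i j : Fin 2 => if i.val + j.val + 1 = 2 then (1 : ℂ) else 0))) : GL (Fin 2) ℂ) : Matrix (Fin 2) (Fin 2) ℂ) i j‖ ^ 2 := by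
      rw [measurable_quotient_iff (H := Subgroup.centralizer ({γ} : Set ↥(unitaryGroupOfForm (starRingEnd ℂ) (Matrix.of fun i j : Fin 2 => if i.val + j.val + 1 = 2 then (1 : ℂ) else 0)))) hT]
      have e1 : (fun x : ↥(unitaryGroupOfForm (starRingEnd ℂ) (Matrix.of fun i j : Fin 2 => if i.val + j.val + 1 = 2 then (1 : ℂ) else 0)) ⧸ Subgroup.centralizer ({γ} : Set ↥(unitaryGroupOfForm (starRingEnd ℂ) (Matrix.of fun i j : Fin 2 => if i.val + j.val + 1 = 2 then (1 : ℂ) else 0))) => ∑ i : Fin 2, ∑ j : Fin 2, ‖(((x.out * γ * x.out⁻¹ : ↥(unitaryGroupOfForm (starRingEnd ℂ) (Matrix.of fun i j : Fin 2 => if i.val + j.val + 1 = 2 then (1 : ℂ) else 0))) : GL (Fin 2) ℂ) : Matrix (Fin 2) (Fin 2) ℂ) i j‖ ^ 2) ∘ (QuotientGroup.mk : ↥(unitaryGroupOfForm (starRingEnd ℂ) (Matrix.of fun i j : Fin 2 => if i.val + j.val + 1 = 2 then (1 : ℂ) else 0)) → ↥(unitaryGroupOfForm (starRingEnd ℂ)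 (Matrix.of fun i j : Fin 2 => if i.val + j.val + 1 = 2 then (1 : ℂ) else 0)) ⧸ Subgroup.centralizer ({γ} : Set ↥(unitaryGroupOfForm (starRingEnd ℂ) (Matrix.of fun i j : Fin 2 => if i.val + j.val + 1 = 2 then (1 : ℂ) else 0)))) =
          fun g : ↥(unitaryGroupOfForm (starRingEnd ℂ) (Matrix.of fun i j : Fin 2 => if i.val + j.val + 1 = 2 then (1 : ℂ) else 0)) => ∑ i : Fin 2, ∑ j : Fin 2, ‖(((g * γ * g⁻¹ : ↥(unitaryGroupOfForm (starRingEnd ℂ) (Matrix.of fun i j : Fin 2 => if i.val + j.val + 1 = 2 then (1 : ℂ) else 0))) : GL (Fin 2) ℂ) : Matrix (Fin 2) (Fin 2) ℂ) i j‖ ^ 2 := by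
        funext g; exact hs_out_conj_eq γ g
      rw [e1]
      exact (hHS1 (fun g : ↥(unitaryGroupOfForm (starRingEnd ℂ) (Matrix.of fun i j : Fin 2 => if i.val + j.val + 1 = 2 then (1 : ℂ) else 0)) => g * γ * g⁻¹) hconj1).measurable
    exact measurableSet_le hP measurable_const
  -- the pulled-back ball is the `h`-translate of the model ball
  have hpre : cosetCongr f _ _ (forall_apply_mem_centralizer_singleton_iff_of_eq f hfγ) ⁻¹' E₀ = (fun x : ↥(unitaryGroupOfForm (starRingEnd ℂ) (Matrix.of fun i j : Fin 2 => if i.val + j.val + 1 = 2 then (1 : ℂ) else 0)) ⧸ Subgroup.centralizer ({γ} : Set ↥(unitaryGroupOfForm (starRingEnd ℂ) (Matrix.of fun i j : Fin 2 => if i.val + j.val + 1 = 2 then (1 : ℂ) else 0))) => h • x) ⁻¹' E := by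
    ext x
    induction x using QuotientGroup.induction_on with
    | H g =>
      simp only [Set.mem_preimage, hE₀, hE, Set.mem_setOf_eq, cosetCongr_mk, descConj_mk, MulAction.Quotient.smul_mk, smul_eq_mul]
      rw [hs_out_conj_eq γ (h * g)]
      have key : e (f g * γ₀ * (f g)⁻¹) = h * g * γ * (h * g)⁻¹ := by
        rw [map_mul, map_mul, map_inv, hef, hconj]
        group
      rw [key]
  -- instances for the model measure
  haveI : SMulInvariantMeasure ↥(unitaryGroupOfForm (starRingEnd ℂ) (Matrix.of fun i j : Fin 2 => if i.val + j.val + 1 = 2 then (1 : ℂ) else 0)) (↥(unitaryGroupOfForm (starRingEnd ℂ) (Matrix.of fun i j : Fin 2 => if i.val + j.val + 1 = 2 then (1 : ℂ) else 0)) ⧸ Subgroup.centralizer ({γ} : Set ↥(unitaryGroupOfForm (starRingEnd ℂ) (Matrix.of fun i j : Fin 2 => if i.val + j.val + 1 = 2 then (1 : ℂ) else 0)))) μ := by rw [hμ]; infer_instance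
  have hmeas : Measurable (cosetCongr f _ _ (forall_apply_mem_centralizer_singleton_iff_of_eq f hfγ)) :=
    (continuous_cosetCongr f _ _ _ hfc).measurable
  calc μ₀ E₀ = (c' : ℝ≥0∞) * μ (cosetCongr f _ _ (forall_apply_mem_centralizer_singleton_iff_of_eq f hfγ) ⁻¹' E₀) := by
        rw [hμ₀eq, Measure.smul_apply, Measure.map_apply hmeas hE₀m, ENNReal.smul_def, smul_eq_mul]
    _ = (c' : ℝ≥0∞) * μ ((fun x : ↥(unitaryGroupOfForm (starRingEnd ℂ) (Matrix.of fun i j : Fin 2 => if i.val + j.val + 1 = 2 then (1 : ℂ) else 0)) ⧸ Subgroup.centralizer ({γ} : Set ↥(unitaryGroupOfForm (starRingEnd ℂ) (Matrix.of fun i j : Fin 2 => if i.val + j.val + 1 = 2 then (1 : ℂ) else 0))) => h • x) ⁻¹' E) := by rw [hpre]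
    _ = (c' : ℝ≥0∞) * μ E := by rw [SMulInvariantMeasure.measure_preimage_smul (μ := μ) h hEm]
    _ ≤ (c' : ℝ≥0∞) * ENNReal.ofReal (C * Real.sqrt R) := by gcongr; exact hC R
    _ = ENNReal.ofReal ((c' : ℝ) * C * Real.sqrt R) := by
        rw [mul_assoc, ENNReal.ofReal_mul (NNReal.coe_nonneg c'), ENNReal.ofReal_coe_nnreal]

/-- **The same in the letters of the (CONV) assembler's per-place token `hplace`**: radius `Σ|(e(x γ₀ x⁻¹))_ij|² + 1`, bound `C · t^(1∕2)` for `t ≥ 1`.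
[cite: BeuzartPlessis2020Asterisque, §1.8 p. 39; §1.2 (1.2.2), (1.2.4) p. 21] -/
theorem exists_measure_descConj_hs_add_one_le_rpow_of_split
    (e : G₀ ≃* ↥(unitaryGroupOfForm (starRingEnd ℂ) (Matrix.of fun i j : Fin 2 => if i.val + j.val + 1 = 2 then (1 : ℂ) else 0))) (he : Continuous e) (hes : Continuous e.symm)
    {γ : ↥(unitaryGroupOfForm (starRingEnd ℂ) (Matrix.of fun i j : Fin 2 => if i.val + j.val + 1 = 2 then (1 : ℂ) else 0))} {z₀ : ℂ} {a b : ℝ} (hγ : (((γ : ↥(unitaryGroupOfForm (starRingEnd ℂ) (Matrix.of fun i j : Fin 2 => if i.val + j.val + 1 = 2 then (1 : ℂ) else 0))) : GL (Fin 2) ℂ) : Matrix (Fin 2) (Fin 2) ℂ) = !![z₀ * a, 0; 0, z₀ * b]) (hz₀ : ‖z₀‖ = 1) (hab : a ≠ b)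
    (ν : Measure ↥(unitaryGroupOfForm (starRingEnd ℂ) (Matrix.of fun i j : Fin 2 => if i.val + j.val + 1 = 2 then (1 : ℂ) else 0))) [ν.IsHaarMeasure] [ν.IsMulRightInvariant] [ν.IsInvInvariant]
    (ρ : Measure ↥(Subgroup.centralizer ({γ} : Set ↥(unitaryGroupOfForm (starRingEnd ℂ) (Matrix.of fun i j : Fin 2 => if i.val + j.val + 1 = 2 then (1 : ℂ) else 0))))) [ρ.IsHaarMeasure] [ρ.IsInvInvariant]
    [MeasurableSpace (↥(unitaryGroupOfForm (starRingEnd ℂ) (Matrix.of fun i j : Fin 2 => if i.val + j.val + 1 = 2 then (1 : ℂ) else 0)) ⧸ Subgroup.centralizer ({γ} : Set ↥(unitaryGroupOfForm (starRingEnd ℂ) (Matrix.of fun i j : Fin 2 => if i.val + j.val + 1 = 2 then (1 : ℂ) else 0))))] [BorelSpace (↥(unitaryGroupOfForm (starRingEnd ℂ) (Matrix.of fun i j : Fin 2 => if i.val + j.val + 1 = 2 then (1 : ℂ) else 0)) ⧸ Subgroup.centralizer ({γ} : Set ↥(unitaryGroupOfForm (starRingEnd ℂ) (Matrix.of fun i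 j : Fin 2 => if i.val + j.val + 1 = 2 then (1 : ℂ) else 0))))]
    (μc : Measure Circle) [IsFiniteMeasure μc] {c : ℝ≥0} (hc : c ≠ 0)
    (hν : Measure.map archPlaneLiftUnitary (μc.prod iwasawaMeasure) = c • ν)
    {γ₀ : G₀} (h : ↥(unitaryGroupOfForm (starRingEnd ℂ) (Matrix.of fun i j : Fin 2 => if i.val + j.val + 1 = 2 then (1 : ℂ) else 0))) (hconj : e γ₀ = h * γ * h⁻¹)
    [MeasurableSpace (G₀ ⧸ Subgroup.centralizer ({γ₀} : Set G₀))] [BorelSpace (G₀ ⧸ Subgroup.centralizer ({γ₀} : Set G₀))]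
    (μ₀ : Measure (G₀ ⧸ Subgroup.centralizer ({γ₀} : Set G₀))) [SMulInvariantMeasure G₀ (G₀ ⧸ Subgroup.centralizer ({γ₀} : Set G₀)) μ₀] [IsFiniteMeasureOnCompacts μ₀] :
    ∃ C : ℝ, ∀ t : ℝ, 1 ≤ t → μ₀ {x | descConj γ₀ (Subgroup.centralizer ({γ₀} : Set G₀)) (centralizer_comm γ₀)
        (fun y : G₀ => ∑ i : Fin 2, ∑ j : Fin 2, ‖(((e y : ↥(unitaryGroupOfForm (starRingEnd ℂ) (Matrix.of fun i j : Fin 2 => if i.val + j.val + 1 = 2 then (1 : ℂ) else 0))) : GL (Fin 2) ℂ) : Matrix (Fin 2) (Fin 2) ℂ) i j‖ ^ 2 + 1) x ≤ t} ≤ ENNReal.ofReal (C * t ^ (1 / (2 : ℝ))) := by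
  obtain ⟨C, hC⟩ := exists_measure_descConj_hs_le_sqrt_of_split e he hes hγ hz₀ hab ν ρ μc hc hν h hconj μ₀
  refine ⟨max C 0, fun t ht => ?_⟩
  have hsub : {x : G₀ ⧸ Subgroup.centralizer ({γ₀} : Set G₀) | descConj γ₀ (Subgroup.centralizer ({γ₀} : Set G₀)) (centralizer_comm γ₀)
        (fun y : G₀ => ∑ i : Fin 2, ∑ j : Fin 2, ‖(((e y : ↥(unitaryGroupOfForm (starRingEnd ℂ) (Matrix.of fun i j : Fin 2 => if i.val + j.val + 1 = 2 then (1 : ℂ) else 0))) : GL (Fin 2) ℂ) : Matrix (Fin 2) (Fin 2) ℂ) i j‖ ^ 2 + 1) x ≤ t} ⊆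
      {x | descConj γ₀ (Subgroup.centralizer ({γ₀} : Set G₀)) (centralizer_comm γ₀)
        (fun y : G₀ => ∑ i : Fin 2, ∑ j : Fin 2, ‖(((e y : ↥(unitaryGroupOfForm (starRingEnd ℂ) (Matrix.of fun i j : Fin 2 => if i.val + j.val + 1 = 2 then (1 : ℂ) else 0))) : GL (Fin 2) ℂ) : Matrix (Fin 2) (Fin 2) ℂ) i j‖ ^ 2) x ≤ t} := by
    intro x hx
    induction x using QuotientGroup.induction_on with
    | H g =>
      simp only [Set.mem_setOf_eq, descConj_mk] at hx ⊢
      linarith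
  refine (measure_mono hsub).trans ((hC t).trans (ENNReal.ofReal_le_ofReal ?_))
  rw [Real.sqrt_eq_rpow]
  exact mul_le_mul_of_nonneg_right (le_max_left _ _) (Real.rpow_nonneg (by linarith) _)

end Transport

end Literature.NumberTheory.Rogawski1990

end
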